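import Summits.ValiantsHypothesis.ValiantsHypothesis.Theses.LacunarySymmetroid
import Summits.ValiantsHypothesis.ValiantsHypothesis.Theorems.LacunarySymmetroidMatrixDescartesNegSquaresSector
import Summits.ValiantsHypothesis.ValiantsHypothesis.Theorems.LacunarySymmetroidMatrixDescartesCensusFrame
import Summits.ValiantsHypothesis.ValiantsHypothesis.Theorems.LacunarySymmetroidMatrixDescartesStubArith4
import Summits.ValiantsHypothesis.ValiantsHypothesis.Theorems.LacunarySymmetroidMatrixDescartesStubPsdDominate
import Summits.ValiantsHypothesis.ValiantsHypothesis.Theorems.LacunarySymmetroidMatrixDescartesRankOneWitness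
import Summits.ValiantsHypothesis.ValiantsHypothesis.Theorems.SymmetroidPencilBasics

/-!
# Line `negsquares` — the NEGATIVE-SQUARES LAW (crux `MatrixDescartes`, stmt-ValiantsHypothesis-18050)

Ideator seat `val-idea-6`, generation 5 (lens «assume the law fails — what would VNP-hardness need?»).
HONEST FRAME: `VP ≠ VNP` is not moved; conjecture B (`KPlusLogSqLaw`) is untouched; the one `sorry` of this
file is the registered stub `stub_negSquaresLaw`, a CONJECTURE OF THE SEAT.  Everything else is proved.

## The lever (degree-free, height-free, read off the SIGN STRUCTURE of the coefficients)

Write each coefficient as a difference of positive semidefinite matrices, `S l = P l − N l`, and let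
`κ := Σ_l rank (N l)` — the number of NEGATIVE SQUARES spent.  (Minimising over splittings gives
`κ(F) = Σ_l n₋(S l)`, the total negative inertia of the letters; replacing `F` by `−F` one may use
`min(Σ n₋, Σ n₊)`.)  `κ` is the Pontryagin index of the translation kernel `(x, y) ↦ F(e^{x+y})`:
for any `r ≥ K` distinct reals `x_i` the block moment matrix `[F(e^{x_i} e^{x_j})]_{i,j}` is congruent to
`(E ⊗ 1) (⊕_l S l) (E ⊗ 1)ᵀ` with `E = [e^{d_l x_i}]` a (totally positive, full column rank) generalised
Vandermonde matrix, so its inertia is exactly `(Σ n₊(S l), Σ n₋(S l))` — independent of `r`, of the degree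
and of the spacing of the exponents (Krein–Langer «kernels with κ negative squares»; `κ = 0` is the
Bernstein–Widder / exponentially convex case).  For `m = 1` Laguerre's rule of signs (1883) reads `Z₊ ≤ 2κ`.

## The law (`NegSquaresLaw`, the stub) and why this grading, not the sign-word grading

  `Z₊(det Σ_l X^{d_l}(P_l − N_l)) ≤ 2 ^ (a · (log₂ m + log₂ K + 1) · (log₂ κ + 1))`,   `κ = Σ_l rank N_l`.

* `κ = 0`: no positive zero at all — PROVED below (`posRoots_eq_zero_of_posSemidef`, the base rung).
* `κ = 1`: the two-sided rank-one sector of line `Lift`; its `K`-free form `Z₊ ≤ 2m` is FALSE (tree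
  `not_rankOneLaw_two`: `m = 2`, five rank-one PSD letters and one `−wwᵀ`, `Z₊ = 6`), which is why the law
  carries the factor `log₂ m + log₂ K + 1`; the polynomial form `NegSquaresOneLaw` below is the first open rung.
* `κ = m` at size `n = m(K+1)`: the image of the cell's universality (Theorem U, `UniversalityV2.md`: every
  symmetric `(m,K)` pencil lifts to ONE negative letter `J⁻` of rank `m` plus PSD letters).  The sign-word
  grading `V` of line `sign_split` (BMD) is collapsed by U to `V = 2` and is false there modulo H
  (Corollary K: the lifted bump monsters have `log Z₊ = Ω(log² n)` inside `V = 2`).  The negative-squares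
  grading is NOT collapsed: the same monsters have `κ = 2k = poly(n)`, and the law predicts for them
  `log Z₊ ≤ a (log n + log K + 1)(log κ + 1) = O(log² n)` — consistent.  The law says: ROOTS ARE PAID FOR BY
  NEGATIVE SQUARES at a quasi-polynomial exchange rate, and a symmetric lacunary pencil of quasi-polynomial
  size has only `κ ≤ mK` of them.  (What VNP-hardness would need, read through this law: `2^{K^{1-o(1)}}`
  negative squares, i.e. super-quasi-polynomial SIZE — the size bound of the crux is load-bearing exactly as
  `Disproof.lean §A matrixDescartes_false_without_sizeBound` demands; the law spends it through `κ ≤ mK`.)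
* Census rows (`Disproof.lean §C`, eleven-thirds register): every decided format is far inside the law for
  `a = 1` (e.g. `(2,6)`: `κ ≤ 6`, bound `2^{4·3}`) — NON-BINDING (critics #36/#32: no decided format can
  stress small κ).  The law is asymptotic in content.
* v2 (after VERDICTS crit-1 #36 + NOTE #39, crit-2 #32 = PASS-WITH-PRICE): on the slice `κ ≤ mK` the law is
  QP-MDR-shaped (S⁺, stronger than the crux and than B for `K ≫ log²(mK)`) — priced as such; the `κ = 1` rung
  is bounded ABOVE by `2·C(K+m−2, m−1)` (critics' determinant lemma `det(P − x^e wwᵀ) = det P − x^e·wᵀadj P w`,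
  both parts coefficient-nonnegative, + the DOUBLED DESCARTES tool proved below,
  `card_posRoots_le_two_mul_negCoeffCount`: distinct positive zeros ≤ 2 · #negative coefficients), so it can
  only fail on the diagonal `m ≈ K → ∞`, in tropically SPECIAL position (#39: generic position is polynomial);
  new in v2, all proved: `m = 1` rung `scalar_rung` (`Z₊ ≤ 2κ`), `negSquaresOneLaw_of : NegSquaresLaw →
  NegSquaresOneLaw` (the first rung is an instance BY NAME, critics' P4); v2.1, proved IN THE KERNEL: the
  `m = 2`, `κ = 1` rung `rankOne_two_le` (`Z₊ ≤ 2K`, all exponents and heights) and `door26_rankOne_sector`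
  (`≤ 12 ≤ 19` on the `(2,6)` door: every `DoorA26` violator has `κ ≥ 2`); v2.2, proved IN THE KERNEL: the
  SEMIDEFINITE-WORD sector at `m = 2`, `semidefinite_pair_two_le` (`Z₊ ≤ 2·K_P·K_N`, PSD letters against NSD
  letters, any exponents incl. repeats, any interleaving) and `door26_semidefinite_sector` (`≤ 18 ≤ 19` on the
  `(2,6)` door: every `DoorA26` violator has an indefinite letter — the class of line `sign_split` at `m = 2` is
  closed V-free); v2.3 (g6, memo `Lines/negsquares-thrift.md`): κ-thrift inspection of the tree's N3 staircase
  (κ* ≥ (m−3)/2, consistent, uninformative) and the COMMUTING `κ = 1` sector — explicit bilinear family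
  `Z₊ = 2(m−1)(K−2)+1` and the located first-stub candidate `CommutingOneLaw` (`Z₊ ≤ 2mK+1`, typed, not
  proved; `commuting_le_of_negSquaresOneLaw` places it under the `κ = 1` rung BY NAME).

## Composition (kernel-checked): `NegSquaresLaw → MatrixDescartes` BY NAME

Split `S l = γ_l•1 − (γ_l•1 − S l)` with `γ_l = 1 + ‖S l‖_F²` (tree `stub_psdDominate`), so `κ ≤ mK`; the law
gives `Z₊ ≤ 2^{a (log m + log K + 1)(log (mK) + 1)}`, reflection (`realRootLawAt_of_posRootLawAt`) gives all real
zeros, and in the crux's regime `m ≤ 2^((log K + c)^c)` the exponent is `O_c((log K + 2c+2)^{2c+2}) = o(K log K)`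
(tree `StubArith4.exp_le`).  For `closes` only the slice `κ ≤ mK` is consumed (= the census's S1 currency);
the grading is the line's INDUCTION VARIABLE (base `κ = 0` proved here, first rung `κ = 1` typed here), and —
unlike `V` — it is not an artefact of the normal form.

## STATUS rev 2.4 (2026-08-28, REWIRED to the tree — val-port-4 g1 for the val-lit merged desk g11, RULING #259 (a); line content UNCHANGED)
The stub-free part (the line's port turnkey `Lines/negsquares_rungs_turnkey.lean`, sha16 d18263607a42fde7; val-idea-crit-1 #41 (A) / #43
«CLEAN FOR PORT») is now in `Theorems/` BY NAME: `…LacunarySymmetroidMatrixDescartesNegSquaresRungs` (p616147: `negCoeffCount`, doubled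
Descartes `card_posRoots_le_two_mul_negCoeffCount`, `scalar_rung`, `rankOne_two_le`, `door26_rankOne_sector`, …) and
`…LacunarySymmetroidMatrixDescartesNegSquaresSector` (p616885: `semidefinite_pair_two_le`, `door26_semidefinite_sector`), namespace
`Summit.ValiantsHypothesis.ValiantsHypothesis.Theorems.LacunarySymmetroidMatrixDescartes.NegSquaresRungs`.  This file (base = v2.3, g6) now IMPORTS
them: `negCoeffCount` is RE-EXPORTED (v2.2 text kept as a comment) and the 19 twin theorems keep NAME + SIGNATURE with by-name bodies; the
line's own vocabulary (`pencil`, `posRoots`, `negSquares`), the laws `NegSquaresLaw` / `NegSquaresOneLaw` / `CommutingOneLaw`, the ONE stub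
`stub_negSquaresLaw` (LAW, 0 provers) and the compositions reaching `MatrixDescartes` BY NAME are UNCHANGED (local).  Sorries 1 → 1
(`stub_negSquaresLaw`); nothing registered changes.
-/

set_option linter.dupNamespace false

namespace Summit.ValiantsHypothesis.ValiantsHypothesis.Cruxes.MatrixDescartes.NegSquares

open Polynomial Matrix Finset
open scoped BigOperators
open Summit.ValiantsHypothesis.ValiantsHypothesis.Theses.LacunarySymmetroid (MatrixDescartes)
open Summit.ValiantsHypothesis.ValiantsHypothesis.Theorems.MatrixDescartes.Negative (PosRootLawAt)
open Summit.ValiantsHypothesis.ValiantsHypothesis.Theorems.LacunarySymmetroidMatrixDescartes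
  (RealRootLawAt stub_psdDominate)
open Summit.ValiantsHypothesis.ValiantsHypothesis.Theorems.LacunarySymmetroidMatrixDescartes.Census
  (realRootLawAt_of_posRootLawAt)
open Summit.ValiantsHypothesis.ValiantsHypothesis.Theorems.SymmetroidDescartes (eval_det_pencil)

/-! ## Objects -/

/-- The lacunary pencil `Σ_l X^{d l} • S l` as a polynomial matrix. -/
noncomputable def pencil {m K : ℕ} (d : Fin K → ℕ) (S : Fin K → Matrix (Fin m) (Fin m) ℝ) :
    Matrix (Fin m) (Fin m) ℝ[X] :=
  ∑ l, (X : ℝ[X]) ^ d l • (S l).map C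

/-- `Z₊`: the number of distinct positive zeros of `det (pencil d S)` (the census currency of `PosRootLawAt`). -/
noncomputable def posRoots {m K : ℕ} (d : Fin K → ℕ) (S : Fin K → Matrix (Fin m) (Fin m) ℝ) : ℕ :=
  ((pencil d S).det.roots.toFinset.filter (fun t => 0 < t)).card

/-- The negative-squares budget of a PSD splitting `S l = P l − N l`: `κ = Σ_l rank (N l)`. -/
noncomputable def negSquares {m K : ℕ} (N : Fin K → Matrix (Fin m) (Fin m) ℝ) : ℕ :=
  ∑ l, (N l).rank

/-! ## The law and its first open rung -/

/-- **THE NEGATIVE-SQUARES LAW** (conjecture of the seat; the stub).  For PSD `P l, N l`: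
`Z₊(det Σ X^{d l}(P l − N l)) ≤ 2 ^ (a (log₂ m + log₂ K + 1)(log₂ κ + 1))`, `κ = Σ rank N l`. -/
def NegSquaresLaw : Prop :=
  ∃ a : ℕ, ∀ (m K : ℕ) (d : Fin K → ℕ) (P N : Fin K → Matrix (Fin m) (Fin m) ℝ),
    (∀ l, (P l).PosSemidef) → (∀ l, (N l).PosSemidef) →
      posRoots d (fun l => P l - N l)
        ≤ 2 ^ (a * (Nat.log 2 m + Nat.log 2 K + 1) * (Nat.log 2 (negSquares N) + 1))

/-- **First open rung (`κ = 1`, polynomial form)**: PSD letters and ONE subtracted rank-one letter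
`X^e • wwᵀ` — the two-sided rank-one sector of line `Lift` — have `Z₊ ≤ (m + K + 2)^a`.  Its `K`-free form
is refuted in the tree (`not_rankOneLaw_two`, `Z₊ = 6 > 2m` at `m = 2`). -/
def NegSquaresOneLaw : Prop :=
  ∃ a : ℕ, ∀ (m K : ℕ) (d : Fin K → ℕ) (e : ℕ) (w : Fin m → ℝ) (P : Fin K → Matrix (Fin m) (Fin m) ℝ),
    (∀ l, (P l).PosSemidef) →
      ((Matrix.det (((X : ℝ[X]) ^ e) • (-Matrix.vecMulVec w w).map C
          + ∑ l, (X : ℝ[X]) ^ d l • (P l).map C)).roots.toFinset.filter (fun t => 0 < t)).card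
        ≤ (m + K + 2) ^ a

/-- **Located first-stub candidate `COMM-1` (val-idea-6 g6, memo `Lines/negsquares-thrift.md` §5): the COMMUTING
`κ = 1` sector — diagonal PSD letters `diagonal (a l)` (`0 ≤ a l i`) and ONE subtracted square `X^e • wwᵀ` — obeys the
bilinear bound `Z₊ ≤ 2·m·K + 1` («two roots per positive square», `2π + 1 ≤ 2mK + 1`).  Located, not proved: the
explicit foot-weaving family has `Z₊ = 2(m−1)(K−2) + 1` ((2,6) = 9, (6,6) = 41, (7,7) = 61); `m = 2` is the kernel
theorem `rankOne_two_le` (`≤ 2K`); the proved general ceiling is `2·C(K+m−2, m−1)` (exponential on the diagonal).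
Cheapest falsifier: a commuting pencil at (m,K) = (4,4)/(5,4)/(6,4) with more than 33/41/49 positive roots. -/
def CommutingOneLaw : Prop :=
  ∀ (m K : ℕ) (d : Fin K → ℕ) (e : ℕ) (w : Fin m → ℝ) (a : Fin K → Fin m → ℝ),
    (∀ l i, 0 ≤ a l i) →
      ((Matrix.det (((X : ℝ[X]) ^ e) • (-Matrix.vecMulVec w w).map C
          + ∑ l, (X : ℝ[X]) ^ d l • (Matrix.diagonal (a l)).map C)).roots.toFinset.filter
            (fun t => 0 < t)).card
        ≤ 2 * m * K + 1

/-- `NegSquaresOneLaw` specialises to the commuting sector with its own (polynomial, non-explicit) bound: the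
commuting sector is an instance of the `κ = 1` rung (diagonal matrices with nonnegative entries are PSD).
[folklore] -/
theorem commuting_le_of_negSquaresOneLaw (h : NegSquaresOneLaw) :
    ∃ a0 : ℕ, ∀ (m K : ℕ) (d : Fin K → ℕ) (e : ℕ) (w : Fin m → ℝ) (a : Fin K → Fin m → ℝ),
      (∀ l i, 0 ≤ a l i) →
        ((Matrix.det (((X : ℝ[X]) ^ e) • (-Matrix.vecMulVec w w).map C
            + ∑ l, (X : ℝ[X]) ^ d l • (Matrix.diagonal (a l)).map C)).roots.toFinset.filter
              (fun t => 0 < t)).card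
          ≤ (m + K + 2) ^ a0 := by
  obtain ⟨a0, ha⟩ := h
  refine ⟨a0, fun m K d e w a hpos => ha m K d e w (fun l => Matrix.diagonal (a l)) fun l => ?_⟩
  exact Matrix.PosSemidef.diagonal (fun i => hpos l i)

/-! ## Stub (the only `sorry`) -/

/-- STUB (the line's one conjecture): the negative-squares law. -/
theorem stub_negSquaresLaw : NegSquaresLaw := by
  sorry

/-! ## Base rung `κ = 0`, PROVED: PSD letters give no positive zero -/

/-- If every coefficient is positive semidefinite, `det (Σ X^{d l} • P l)` has NO positive zero: at a positive
zero `t` some `v ≠ 0` has `Σ t^{d l} vᵀP_l v = 0`, so every `P_l v = 0`, so the determinant vanishes at every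
real point and is the zero polynomial — which has no roots. [folklore] -/
theorem posRoots_eq_zero_of_posSemidef {m K : ℕ} (d : Fin K → ℕ) (P : Fin K → Matrix (Fin m) (Fin m) ℝ)
    (hP : ∀ l, (P l).PosSemidef) : posRoots d P = 0 := by
  classical
  rw [posRoots, Finset.card_eq_zero, Finset.filter_eq_empty_iff]
  intro t ht ht0
  rw [Multiset.mem_toFinset] at ht
  obtain ⟨hp, hroot⟩ := Polynomial.mem_roots'.1 ht
  rw [Polynomial.IsRoot.def, pencil, eval_det_pencil] at hroot
  obtain ⟨v, hv0, hv⟩ := Matrix.exists_mulVec_eq_zero_iff.2 hroot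
  -- every quadratic form `vᵀ P_l v` vanishes
  have hsum : ∑ l, t ^ d l * (v ⬝ᵥ (P l *ᵥ v)) = 0 := by
    have h0 : v ⬝ᵥ ((∑ l, t ^ d l • P l) *ᵥ v) = 0 := by rw [hv, dotProduct_zero]
    rw [Matrix.sum_mulVec, dotProduct_sum] at h0
    simpa only [Matrix.smul_mulVec, dotProduct_smul, smul_eq_mul] using h0
  have hnn : ∀ l ∈ (Finset.univ : Finset (Fin K)), 0 ≤ t ^ d l * (v ⬝ᵥ (P l *ᵥ v)) := by
    intro l _
    have h := (hP l).dotProduct_mulVec_nonneg v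
    rw [star_trivial] at h
    exact mul_nonneg (pow_nonneg ht0.le _) h
  have hq : ∀ l, v ⬝ᵥ (P l *ᵥ v) = 0 := by
    intro l
    have h := (Finset.sum_eq_zero_iff_of_nonneg hnn).1 hsum l (Finset.mem_univ l)
    rcases mul_eq_zero.1 h with h | h
    · exact absurd h (pow_ne_zero _ ht0.ne')
    · exact h
  have hker : ∀ l, P l *ᵥ v = 0 := by
    intro l
    have h := hq l
    rw [← star_trivial v] at h
    exact ((hP l).dotProduct_mulVec_zero_iff v).1 (by simpa only [star_trivial] using h)
  -- hence the determinant vanishes at EVERY real point, so it is the zero polynomial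
  have hdet : ∀ s : ℝ, ((pencil d P).det).eval s = 0 := by
    intro s
    rw [pencil, eval_det_pencil]
    refine Matrix.exists_mulVec_eq_zero_iff.1 ⟨v, hv0, ?_⟩
    rw [Matrix.sum_mulVec]
    refine Finset.sum_eq_zero fun l _ => ?_
    rw [Matrix.smul_mulVec, hker l, smul_zero]
  exact hp (Polynomial.funext fun s => by rw [hdet s, eval_zero])

/-- The base rung in the law's own shape: with no negative squares the count is `0`. -/
theorem negSquaresLaw_base {m K : ℕ} (d : Fin K → ℕ) (P : Fin K → Matrix (Fin m) (Fin m) ℝ)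
    (hP : ∀ l, (P l).PosSemidef) : posRoots d (fun l => P l - 0) = 0 := by
  simpa only [sub_zero] using posRoots_eq_zero_of_posSemidef d P hP

/-! ## The law contains its `κ = 1` rung (so `NegSquaresOneLaw` is a genuine first target) -/

/-- Rewriting the rank-one sector as a PSD splitting with `κ ≤ 1`. -/
theorem negSquaresOneLaw_of_negSquaresLaw (h : NegSquaresLaw) :
    ∃ a : ℕ, ∀ (m K : ℕ) (d : Fin K → ℕ) (e : ℕ) (w : Fin m → ℝ) (P : Fin K → Matrix (Fin m) (Fin m) ℝ),
      (∀ l, (P l).PosSemidef) →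
        posRoots (Fin.cons (α := fun _ => ℕ) e d)
            (fun l => Fin.cons (α := fun _ => Matrix (Fin m) (Fin m) ℝ) 0 P l
              - Fin.cons (α := fun _ => Matrix (Fin m) (Fin m) ℝ) (Matrix.vecMulVec w w) (fun _ => 0) l)
          ≤ 2 ^ (a * (Nat.log 2 m + Nat.log 2 (K + 1) + 1) * (Nat.log 2 1 + 1)) := by
  obtain ⟨a, ha⟩ := h
  refine ⟨a, fun m K d e w P hP => ?_⟩
  have hPc : ∀ l : Fin (K + 1),
      (Fin.cons (α := fun _ => Matrix (Fin m) (Fin m) ℝ) 0 P l).PosSemidef := by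
    intro l
    refine Fin.cases ?_ (fun i => ?_) l
    · simpa using Matrix.PosSemidef.zero
    · simpa using hP i
  have hNc : ∀ l : Fin (K + 1),
      (Fin.cons (α := fun _ => Matrix (Fin m) (Fin m) ℝ) (Matrix.vecMulVec w w) (fun _ => 0) l).PosSemidef := by
    intro l
    refine Fin.cases ?_ (fun i => ?_) l
    · simpa using Matrix.posSemidef_vecMulVec_self_star (R := ℝ) w
    · simpa using Matrix.PosSemidef.zero
  have hκ : negSquares (K := K + 1)
      (Fin.cons (α := fun _ => Matrix (Fin m) (Fin m) ℝ) (Matrix.vecMulVec w w) (fun _ => 0)) ≤ 1 := by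
    unfold negSquares
    rw [Fin.sum_univ_succ]
    simp only [Fin.cons_zero, Fin.cons_succ, Matrix.rank_zero, Finset.sum_const_zero, add_zero]
    exact Matrix.rank_vecMulVec_le w w
  have h1 := ha m (K + 1) (Fin.cons (α := fun _ => ℕ) e d) _ _ hPc hNc
  refine h1.trans (Nat.pow_le_pow_right (by norm_num) ?_)
  have : Nat.log 2 (negSquares (K := K + 1)
      (Fin.cons (α := fun _ => Matrix (Fin m) (Fin m) ℝ) (Matrix.vecMulVec w w) (fun _ => 0)))
        ≤ Nat.log 2 1 := by
    rw [Nat.log_one_right]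
    have := Nat.log_mono_right (b := 2) hκ
    simpa using this
  exact Nat.mul_le_mul_left _ (Nat.add_le_add_right this 1)

/-- The `Fin.cons` splitting used above IS the rank-one-sector pencil of `NegSquaresOneLaw`. -/
theorem pencil_cons_rankOne {m K : ℕ} (d : Fin K → ℕ) (e : ℕ) (w : Fin m → ℝ)
    (P : Fin K → Matrix (Fin m) (Fin m) ℝ) :
    pencil (Fin.cons (α := fun _ => ℕ) e d)
        (fun l => Fin.cons (α := fun _ => Matrix (Fin m) (Fin m) ℝ) 0 P l
          - Fin.cons (α := fun _ => Matrix (Fin m) (Fin m) ℝ) (Matrix.vecMulVec w w) (fun _ => 0) l)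
      = ((X : ℝ[X]) ^ e) • (-Matrix.vecMulVec w w).map C + ∑ l, (X : ℝ[X]) ^ d l • (P l).map C := by
  unfold pencil
  rw [Fin.sum_univ_succ]
  simp only [Fin.cons_zero, Fin.cons_succ, zero_sub, sub_zero]

/-- `2 ^ log₂ n ≤ n + 1` (also at `n = 0`). -/
theorem two_pow_log_le_succ (n : ℕ) : 2 ^ Nat.log 2 n ≤ n + 1 := by
  rcases Nat.eq_zero_or_pos n with rfl | hn
  · simp
  · exact (Nat.pow_log_le_self 2 hn.ne').trans (Nat.le_succ n)

/-- **P4 (critics #32/#36): the first rung is an instance of the law BY NAME.**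
`NegSquaresLaw → NegSquaresOneLaw`, with exponent `2a`: `2^(a(log m + log (K+1) + 1)) ≤ (2(m+1)(K+1))^a ≤ (m+K+2)^(2a)`. -/
theorem negSquaresOneLaw_of (h : NegSquaresLaw) : NegSquaresOneLaw := by
  obtain ⟨a, ha⟩ := negSquaresOneLaw_of_negSquaresLaw h
  refine ⟨2 * a, fun m K d e w P hP => ?_⟩
  have h1 := ha m K d e w P hP
  unfold posRoots at h1
  rw [pencil_cons_rankOne] at h1
  refine h1.trans ?_
  have key : 2 ^ (Nat.log 2 m + Nat.log 2 (K + 1) + 1) ≤ (m + K + 2) ^ 2 := by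
    have hm := two_pow_log_le_succ m
    have hK := two_pow_log_le_succ (K + 1)
    rw [pow_succ, pow_add]
    nlinarith [Nat.zero_le m, Nat.zero_le K, Nat.zero_le (2 ^ Nat.log 2 m), Nat.zero_le (2 ^ Nat.log 2 (K + 1)),
      Nat.mul_le_mul hm hK]
  calc 2 ^ (a * (Nat.log 2 m + Nat.log 2 (K + 1) + 1) * (Nat.log 2 1 + 1))
      = (2 ^ (Nat.log 2 m + Nat.log 2 (K + 1) + 1)) ^ a := by
        rw [Nat.log_one_right, zero_add, mul_one, mul_comm, pow_mul]
    _ ≤ ((m + K + 2) ^ 2) ^ a := Nat.pow_le_pow_left key a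
    _ = (m + K + 2) ^ (2 * a) := by rw [← pow_mul]

/-! ## Doubled Descartes (PROVED, general tool): positive zeros ≤ 2 · #negative coefficients

Mathlib's rule of signs (`Polynomial.roots_countP_pos_le_signVariations`) bounds positive roots by sign
changes; a sign change needs a negative coefficient next to it, so `signVariations ≤ 2 · #{n : coeff n < 0}`.
This is the counting tool behind every "negative monomials live on few exponents" rung of the line
(m = 1 below; the critics' `κ = 1` lemma `Z₊ ≤ 2·C(K+m−2, m−1)`, = `2K` at m = 2, NOTE #36/#32). -/

/- (rev 2.4: `negCoeffCount` — docstring of the v2.2 local definition, now RE-EXPORTED from `Theorems.LacunarySymmetroidMatrixDescartes.NegSquaresRungs`) The number of negative coefficients of a real polynomial. -/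
export Summit.ValiantsHypothesis.ValiantsHypothesis.Theorems.LacunarySymmetroidMatrixDescartes.NegSquaresRungs (negCoeffCount)
-- rev 2.4: the v2.2 text was:
--   noncomputable def negCoeffCount (P : ℝ[X]) : ℕ := (P.support.filter (fun n => P.coeff n < 0)).card

theorem negCoeffCount_eq_eraseLead_add {P : ℝ[X]} (hP : P ≠ 0) :
    negCoeffCount P = negCoeffCount P.eraseLead + (if P.leadingCoeff < 0 then 1 else 0) :=
  Theorems.LacunarySymmetroidMatrixDescartes.NegSquaresRungs.negCoeffCount_eq_eraseLead_add hP

/-- **Doubled Descartes, inductive form**: `signVariations P + [leadingCoeff P < 0] ≤ 2 · negCoeffCount P`. -/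
theorem signVariations_add_ite_le (P : ℝ[X]) :
    P.signVariations + (if P.leadingCoeff < 0 then 1 else 0) ≤ 2 * negCoeffCount P :=
  Theorems.LacunarySymmetroidMatrixDescartes.NegSquaresRungs.signVariations_add_ite_le P

/-- **Doubled Descartes**: distinct positive zeros `≤ 2 · #negative coefficients`. -/
theorem card_posRoots_le_two_mul_negCoeffCount (P : ℝ[X]) :
    (P.roots.toFinset.filter (fun t => 0 < t)).card ≤ 2 * negCoeffCount P :=
  Theorems.LacunarySymmetroidMatrixDescartes.NegSquaresRungs.card_posRoots_le_two_mul_negCoeffCount P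

/-- By symmetry (`roots (−P) = roots P`): distinct positive zeros `≤ 2 · #positive coefficients` too. -/
theorem card_posRoots_le_two_mul_negCoeffCount_neg (P : ℝ[X]) :
    (P.roots.toFinset.filter (fun t => 0 < t)).card ≤ 2 * negCoeffCount (-P) :=
  Theorems.LacunarySymmetroidMatrixDescartes.NegSquaresRungs.card_posRoots_le_two_mul_negCoeffCount_neg P

/-! ## The `m = 1` rung, PROVED: `Z₊ ≤ 2κ` for scalar pencils

At `m = 1` a PSD splitting is `s_l = p_l − n_l` with `p_l, n_l ≥ 0` and `κ = #{l : n_l ≠ 0}`; a negative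
coefficient of `Σ_l (p_l − n_l) X^{d_l}` sits at an exponent `d_l` with `n_l ≠ 0`, so doubled Descartes gives
`Z₊ ≤ 2κ` — the law's `m = 1` shape with room to spare (`2κ ≤ 2^(a·(log K + 1)(log κ + 1))`). -/

/-- **`m = 1` rung (PROVED).** -/
theorem scalar_rung {K : ℕ} (d : Fin K → ℕ) (p n : Fin K → ℝ) (hp : ∀ l, 0 ≤ p l) :
    ((∑ l, C (p l - n l) * (X : ℝ[X]) ^ d l).roots.toFinset.filter (fun t => 0 < t)).card
      ≤ 2 * (Finset.univ.filter (fun l => n l ≠ 0)).card :=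
  Theorems.LacunarySymmetroidMatrixDescartes.NegSquaresRungs.scalar_rung d p n hp

/-! ## The `κ = 1` rung at `m = 2` — PROVED in the kernel (v2.1)

Critics' lemma (#36 (iii) / #32 (i)) in its `m = 2` form: for PSD `2×2` letters `P l` and one subtracted
rank-one letter `X^e·wwᵀ`, `det = (A·C − B²) − X^e·q` where `A, B, C` are the entry sums and
`q = (w₁,−w₀)ᵀ(Σ X^{d l}P_l)(w₁,−w₀)`; the `X^n`-coefficient of `A·C − B²` is
`½ Σ_{d l + d l' = n} (a_l c_{l'} + a_{l'} c_l − 2 b_l b_{l'}) ≥ 0` (AM-GM on `b_l² ≤ a_l c_l`), so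
negative coefficients occur only at the `≤ K` exponents `e + d l`, and the doubled Descartes tool gives
**`Z₊ ≤ 2K`** — in particular `≤ 12 ≤ 19` on the `(2,6)` door (`DoorA26`, stmt-19979) for every pencil of
its `κ ≤ 1` sector: a `DoorA26` violator spends at least two negative squares. -/

theorem two_mul_le_of_psd2 (a b c a' b' c' : ℝ) (ha : 0 ≤ a) (hc : 0 ≤ c) (ha' : 0 ≤ a') (hc' : 0 ≤ c')
    (h1 : b ^ 2 ≤ a * c) (h2 : b' ^ 2 ≤ a' * c') : 2 * (b * b') ≤ a * c' + a' * c :=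
  Theorems.LacunarySymmetroidMatrixDescartes.NegSquaresRungs.two_mul_le_of_psd2 a b c a' b' c' ha hc ha' hc' h1 h2

theorem entry_eq {K : ℕ} (d : Fin K → ℕ) (e : ℕ) (w : Fin 2 → ℝ) (P : Fin K → Matrix (Fin 2) (Fin 2) ℝ)
    (i j : Fin 2) :
    (((X : ℝ[X]) ^ e) • (-Matrix.vecMulVec w w).map C + ∑ l, (X : ℝ[X]) ^ d l • (P l).map C) i j
      = -(C (w i * w j) * X ^ e) + ∑ l, C (P l i j) * X ^ d l :=
  Theorems.LacunarySymmetroidMatrixDescartes.NegSquaresRungs.entry_eq d e w P i j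

/-- Coefficients of a product of two lacunary sums on the same exponents. -/
theorem coeff_sum_mul_sum {K : ℕ} (d : Fin K → ℕ) (x y : Fin K → ℝ) (n : ℕ) :
    ((∑ l, C (x l) * (X : ℝ[X]) ^ d l) * (∑ l, C (y l) * (X : ℝ[X]) ^ d l)).coeff n
      = ∑ l, ∑ l', (if n = d l + d l' then x l * y l' else 0) :=
  Theorems.LacunarySymmetroidMatrixDescartes.NegSquaresRungs.coeff_sum_mul_sum d x y n

/-- Coefficients of a lacunary sum vanish off the exponent set. -/
theorem coeff_sum_eq_zero {K : ℕ} (d : Fin K → ℕ) (x : Fin K → ℝ) (k : ℕ) (hk : ∀ l, k ≠ d l) :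
    (∑ l, C (x l) * (X : ℝ[X]) ^ d l).coeff k = 0 :=
  Theorems.LacunarySymmetroidMatrixDescartes.NegSquaresRungs.coeff_sum_eq_zero d x k hk

/-- The symmetrised AM-GM step: the `X^n` coefficient of `A·C − B²` is nonnegative. -/
theorem double_sum_nonneg {K : ℕ} (d : Fin K → ℕ) (a b c : Fin K → ℝ)
    (ha : ∀ l, 0 ≤ a l) (hc : ∀ l, 0 ≤ c l) (hb : ∀ l, b l ^ 2 ≤ a l * c l) (n : ℕ) :
    0 ≤ (∑ l, ∑ l', (if n = d l + d l' then a l * c l' else 0))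
        - ∑ l, ∑ l', (if n = d l + d l' then b l * b l' else 0) :=
  Theorems.LacunarySymmetroidMatrixDescartes.NegSquaresRungs.double_sum_nonneg d a b c ha hc hb n

/-- **κ = 1 at m = 2 (kernel).**  For PSD `2×2` letters `P l` and one subtracted rank-one letter
`X^e · wwᵀ`, every coefficient of `det` off the exponents `e + d l` is nonnegative. -/
theorem coeff_nonneg_off {K : ℕ} (d : Fin K → ℕ) (e : ℕ) (w : Fin 2 → ℝ)
    (P : Fin K → Matrix (Fin 2) (Fin 2) ℝ) (hP : ∀ l, (P l).PosSemidef) (n : ℕ)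
    (hn : ∀ l, n ≠ e + d l) :
    0 ≤ (Matrix.det (((X : ℝ[X]) ^ e) • (-Matrix.vecMulVec w w).map C
        + ∑ l, (X : ℝ[X]) ^ d l • (P l).map C)).coeff n :=
  Theorems.LacunarySymmetroidMatrixDescartes.NegSquaresRungs.coeff_nonneg_off d e w P hP n hn

/-- **`κ = 1`, `m = 2`: `Z₊ ≤ 2K` (PROVED).**  The two-sided rank-one sector at size 2 obeys the doubled
fewnomial count in the number of PSD letters — uniformly in the exponents `d`, `e` and all heights. -/
theorem rankOne_two_le {K : ℕ} (d : Fin K → ℕ) (e : ℕ) (w : Fin 2 → ℝ)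
    (P : Fin K → Matrix (Fin 2) (Fin 2) ℝ) (hP : ∀ l, (P l).PosSemidef) :
    ((Matrix.det (((X : ℝ[X]) ^ e) • (-Matrix.vecMulVec w w).map C
        + ∑ l, (X : ℝ[X]) ^ d l • (P l).map C)).roots.toFinset.filter (fun t => 0 < t)).card
      ≤ 2 * K :=
  Theorems.LacunarySymmetroidMatrixDescartes.NegSquaresRungs.rankOne_two_le d e w P hP

/-- The `(2,6)` door's `κ ≤ 1` sector (stmt-ValiantsHypothesis-19979 `DoorA26 = PosRootLawAt 2 6 19`):
six PSD `2×2` letters and one subtracted rank-one square at any exponent `e` (equal to some `d l` or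
not) give at most `12 ≤ 19` positive zeros.  So every `DoorA26` violator has `κ ≥ 2`. -/
theorem door26_rankOne_sector (d : Fin 6 → ℕ) (e : ℕ) (w : Fin 2 → ℝ)
    (P : Fin 6 → Matrix (Fin 2) (Fin 2) ℝ) (hP : ∀ l, (P l).PosSemidef) :
    ((Matrix.det (((X : ℝ[X]) ^ e) • (-Matrix.vecMulVec w w).map C
        + ∑ l, (X : ℝ[X]) ^ d l • (P l).map C)).roots.toFinset.filter (fun t => 0 < t)).card
      ≤ 12 :=
  Theorems.LacunarySymmetroidMatrixDescartes.NegSquaresRungs.door26_rankOne_sector d e w P hP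

/-! ## v2.2 — the SEMIDEFINITE-WORD sector at `m = 2`, PROVED: `Z₊ ≤ 2·K_P·K_N`

PSD letters `P l` (exponents `d l`, support `I`) against NSD letters `−N l` (exponents `e l`, support `J`):
`det = (A_P C_P − B_P²) + (A_N C_N − B_N²) − (A_P C_N + C_P A_N − 2 B_P B_N)`; the two pure brackets are
coefficient-nonnegative (AM-GM, `double_sum_nonneg`), the mixed bracket lives on the sumset `d(I) + e(J)`,
so `#negative coefficients ≤ |I|·|J|` and doubled Descartes gives `Z₊ ≤ 2|I||J|`.  In the law's currency:
`K_N ≤ κ`, so on semidefinite words at `m = 2` the law holds with room (`Z₊ ≤ 2Kκ`). -/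

theorem coeff_sum_mul_sum₂ {K : ℕ} (d e : Fin K → ℕ) (x y : Fin K → ℝ) (n : ℕ) :
    ((∑ l, C (x l) * (X : ℝ[X]) ^ d l) * (∑ l, C (y l) * (X : ℝ[X]) ^ e l)).coeff n
      = ∑ l, ∑ l', (if n = d l + e l' then x l * y l' else 0) :=
  Theorems.LacunarySymmetroidMatrixDescartes.NegSquaresRungs.coeff_sum_mul_sum₂ d e x y n

/-- entries of a PSD-minus-PSD two-family pencil at `m = 2` -/
theorem entry_eq₂ {K : ℕ} (d e : Fin K → ℕ) (P N : Fin K → Matrix (Fin 2) (Fin 2) ℝ) (i j : Fin 2) :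
    ((∑ l, (X : ℝ[X]) ^ d l • (P l).map C) - ∑ l, (X : ℝ[X]) ^ e l • (N l).map C) i j
      = (∑ l, C (P l i j) * X ^ d l) - ∑ l, C (N l i j) * X ^ e l :=
  Theorems.LacunarySymmetroidMatrixDescartes.NegSquaresRungs.entry_eq₂ d e P N i j

/-- PSD data of a `2×2` real PSD matrix. -/
theorem psd2_data (M : Matrix (Fin 2) (Fin 2) ℝ) (hM : M.PosSemidef) :
    M 1 0 = M 0 1 ∧ 0 ≤ M 0 0 ∧ 0 ≤ M 1 1 ∧ M 0 1 ^ 2 ≤ M 0 0 * M 1 1 :=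
  Theorems.LacunarySymmetroidMatrixDescartes.NegSquaresRungs.psd2_data M hM

/-- **Semidefinite two-family pencils at `m = 2`.**  PSD letters `P l` at exponents `d l` and NSD letters
`−N l` at exponents `e l`, with `P` supported on `I` and `N` on `J`: every coefficient of `det` off the
sumset `d(I) + e(J)` is nonnegative. -/
theorem coeff_nonneg_off₂ {K : ℕ} (d e : Fin K → ℕ) (P N : Fin K → Matrix (Fin 2) (Fin 2) ℝ)
    (hP : ∀ l, (P l).PosSemidef) (hN : ∀ l, (N l).PosSemidef) (I J : Finset (Fin K))
    (hI : ∀ l, l ∉ I → P l = 0) (hJ : ∀ l, l ∉ J → N l = 0) (n : ℕ)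
    (hn : n ∉ Finset.image₂ (fun l l' => d l + e l') I J) :
    0 ≤ (Matrix.det ((∑ l, (X : ℝ[X]) ^ d l • (P l).map C)
          - ∑ l, (X : ℝ[X]) ^ e l • (N l).map C)).coeff n :=
  Theorems.LacunarySymmetroidMatrixDescartes.NegSquaresRungs.coeff_nonneg_off₂ d e P N hP hN I J hI hJ n hn

theorem semidefinite_pair_two_le {K : ℕ} (d e : Fin K → ℕ) (P N : Fin K → Matrix (Fin 2) (Fin 2) ℝ)
    (hP : ∀ l, (P l).PosSemidef) (hN : ∀ l, (N l).PosSemidef) (I J : Finset (Fin K))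
    (hI : ∀ l, l ∉ I → P l = 0) (hJ : ∀ l, l ∉ J → N l = 0) :
    ((Matrix.det ((∑ l, (X : ℝ[X]) ^ d l • (P l).map C)
          - ∑ l, (X : ℝ[X]) ^ e l • (N l).map C)).roots.toFinset.filter (fun t => 0 < t)).card
      ≤ 2 * (I.card * J.card) :=
  Theorems.LacunarySymmetroidMatrixDescartes.NegSquaresRungs.semidefinite_pair_two_le d e P N hP hN I J hI hJ

/-- **The semidefinite-word sector of the `(2,6)` door is closed: `Z₊ ≤ 18 ≤ 19`** (stmt-ValiantsHypothesis-19979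
`DoorA26 = PosRootLawAt 2 6 19`, same pencil expression).  Six `2×2` letters each PSD or NSD, ANY exponents
(repeats allowed), any heights, any interleaving of the sign word: `Z₊ ≤ 2·K_P·K_N ≤ 18`.  This is the class of
line `sign_split` (semidefinite words, V-currency) at `m = 2`, V-free; by the octave cell's definiteness census
(`Cruxes/WeakLifting/Lines/octave.md` (e)) no record pencil of the eleven-thirds register lies in it — every
`DoorA26` violator has an INDEFINITE letter (and, by `door26_rankOne_sector`, at least two negative squares). -/
theorem door26_semidefinite_sector (d : Fin 6 → ℕ) (S : Fin 6 → Matrix (Fin 2) (Fin 2) ℝ)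
    (hS : ∀ l, (S l).PosSemidef ∨ (-S l).PosSemidef) :
    ((Matrix.det (∑ l, (X : ℝ[X]) ^ d l • (S l).map C)).roots.toFinset.filter
      (fun t => 0 < t)).card ≤ 18 :=
  Theorems.LacunarySymmetroidMatrixDescartes.NegSquaresRungs.door26_semidefinite_sector d S hS

/-! ## Glue (proved): the law, at the slice `κ ≤ mK`, gives the crux -/

/-- Every format satisfies `Z₊ ≤ 2^(a (log m + log K + 1)(log (mK) + 1))` under the law: split each symmetric
letter as `γ•1 − (γ•1 − S)` with `γ = 1 + ‖S‖_F²` (tree `stub_psdDominate`). -/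
theorem posRootLawAt_of_negSquaresLaw {a : ℕ}
    (ha : ∀ (m K : ℕ) (d : Fin K → ℕ) (P N : Fin K → Matrix (Fin m) (Fin m) ℝ),
      (∀ l, (P l).PosSemidef) → (∀ l, (N l).PosSemidef) →
        posRoots d (fun l => P l - N l)
          ≤ 2 ^ (a * (Nat.log 2 m + Nat.log 2 K + 1) * (Nat.log 2 (negSquares N) + 1)))
    (m K : ℕ) :
    PosRootLawAt m K (2 ^ (a * (Nat.log 2 m + Nat.log 2 K + 1) * (Nat.log 2 (m * K) + 1))) := by
  classical
  intro d S hS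
  set γ : Fin K → ℝ := fun l => 1 + ∑ i, ∑ j, S l i j ^ 2 with hγ
  set P : Fin K → Matrix (Fin m) (Fin m) ℝ := fun l => γ l • (1 : Matrix (Fin m) (Fin m) ℝ) with hPdef
  set N : Fin K → Matrix (Fin m) (Fin m) ℝ := fun l => γ l • (1 : Matrix (Fin m) (Fin m) ℝ) - S l with hNdef
  have hP : ∀ l, (P l).PosSemidef := by
    intro l
    refine Matrix.PosSemidef.one.smul ?_
    show (0 : ℝ) ≤ 1 + ∑ i, ∑ j, S l i j ^ 2
    positivity
  have hN : ∀ l, (N l).PosSemidef := fun l => stub_psdDominate m (S l) (hS l)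
  have hPN : (fun l => P l - N l) = S := by
    funext l
    simp [hPdef, hNdef]
  have h1 := ha m K d P N hP hN
  rw [hPN] at h1
  have hκ : negSquares N ≤ m * K := by
    unfold negSquares
    calc ∑ l, (N l).rank ≤ ∑ _l : Fin K, m := Finset.sum_le_sum fun l _ => Matrix.rank_le_width (N l)
      _ = m * K := by simp [mul_comm]
  have h2 : Nat.log 2 (negSquares N) ≤ Nat.log 2 (m * K) := Nat.log_mono_right hκ
  exact h1.trans (Nat.pow_le_pow_right (by norm_num)
    (Nat.mul_le_mul_left _ (Nat.add_le_add_right h2 1)))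

/-- Exponent arithmetic in the crux's regime: with `m ≤ 2^((log K + c)^c)`,
`a (log m + log K + 1)(log (mK) + 1) + 2 ≤ (4a + 2) (log K + (2c+2))^(2c+2)`. -/
theorem exponent_le (a c K m : ℕ) (hm : m ≤ 2 ^ ((Nat.log 2 K + c) ^ c)) :
    a * (Nat.log 2 m + Nat.log 2 K + 1) * (Nat.log 2 (m * K) + 1) + 2
      ≤ (4 * a + 2) * (Nat.log 2 K + (2 * c + 2)) ^ (2 * c + 2) := by
  set L := Nat.log 2 K with hL
  set A := (L + c) ^ c with hA
  have hlogm : Nat.log 2 m ≤ A :=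
    calc Nat.log 2 m ≤ Nat.log 2 (2 ^ A) := Nat.log_mono_right hm
      _ = A := Nat.log_pow one_lt_two _
  have hKlt : K < 2 ^ (L + 1) := Nat.lt_pow_succ_log_self one_lt_two K
  have hmK : m * K ≤ 2 ^ (A + (L + 1)) := by
    rw [pow_add]
    exact Nat.mul_le_mul hm hKlt.le
  have hlogmK : Nat.log 2 (m * K) ≤ A + (L + 1) :=
    calc Nat.log 2 (m * K) ≤ Nat.log 2 (2 ^ (A + (L + 1))) := Nat.log_mono_right hmK
      _ = A + (L + 1) := Nat.log_pow one_lt_two _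
  -- both factors are ≤ y := A + L + 2 ≤ 2 (L + c + 2)^(c+1)
  set y := L + c + 2 with hy
  have hy1 : 1 ≤ y := by omega
  have hAy : A ≤ y ^ (c + 1) :=
    calc A = (L + c) ^ c := hA
      _ ≤ y ^ c := Nat.pow_le_pow_left (by omega) c
      _ ≤ y ^ (c + 1) := Nat.pow_le_pow_right hy1 (Nat.le_succ c)
  have hLy : L + 2 ≤ y ^ (c + 1) :=
    calc L + 2 ≤ y := by omega
      _ ≤ y ^ (c + 1) := Nat.le_self_pow (Nat.succ_ne_zero c) y
  have hf1 : Nat.log 2 m + L + 1 ≤ 2 * y ^ (c + 1) := by omega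
  have hf2 : Nat.log 2 (m * K) + 1 ≤ 2 * y ^ (c + 1) := by omega
  have hprod : (Nat.log 2 m + L + 1) * (Nat.log 2 (m * K) + 1) ≤ 4 * y ^ (2 * c + 2) :=
    calc (Nat.log 2 m + L + 1) * (Nat.log 2 (m * K) + 1) ≤ (2 * y ^ (c + 1)) * (2 * y ^ (c + 1)) :=
          Nat.mul_le_mul hf1 hf2
      _ = 4 * y ^ (2 * c + 2) := by ring
  have hyz : y ^ (2 * c + 2) ≤ (L + (2 * c + 2)) ^ (2 * c + 2) :=
    Nat.pow_le_pow_left (by omega) _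
  set z := (L + (2 * c + 2)) ^ (2 * c + 2) with hz
  have hz1 : 1 ≤ z := Nat.one_le_pow _ _ (by omega)
  calc a * (Nat.log 2 m + L + 1) * (Nat.log 2 (m * K) + 1) + 2
        = a * ((Nat.log 2 m + L + 1) * (Nat.log 2 (m * K) + 1)) + 2 := by ring
    _ ≤ a * (4 * z) + 2 * z := by
        have := Nat.mul_le_mul_left a (hprod.trans (Nat.mul_le_mul_left 4 hyz))
        omega
    _ = (4 * a + 2) * z := by ring

/-- **The glue**: the negative-squares law implies the crux `MatrixDescartes` as printed. -/
theorem matrixDescartes_of_negSquaresLaw (h : NegSquaresLaw) : MatrixDescartes := by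
  obtain ⟨a, ha⟩ := h
  intro c q _hq
  obtain ⟨K₁, hK₁⟩ :=
    Summit.ValiantsHypothesis.ValiantsHypothesis.Theorems.LacunarySymmetroidMatrixDescartes.StubArith4.exp_le
      (2 * c + 2) (q * (4 * a + 2))
  refine ⟨K₁, fun K m hK hm d S hS => ?_⟩
  -- the all-real-zeros row from the positive-zeros row
  set E := a * (Nat.log 2 m + Nat.log 2 K + 1) * (Nat.log 2 (m * K) + 1) with hE
  have hrow : RealRootLawAt m K (2 * 2 ^ E + 1) :=
    realRootLawAt_of_posRootLawAt (posRootLawAt_of_negSquaresLaw ha m K)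
  have hZ := hrow d S hS
  have hB : 2 * 2 ^ E + 1 ≤ 2 ^ (E + 2) := by
    have : 1 ≤ 2 ^ E := Nat.one_le_two_pow
    rw [pow_add]
    omega
  have hexp : q * (E + 2) ≤ K * Nat.log 2 K :=
    calc q * (E + 2) ≤ q * ((4 * a + 2) * (Nat.log 2 K + (2 * c + 2)) ^ (2 * c + 2)) :=
          Nat.mul_le_mul_left q (exponent_le a c K m hm)
      _ = q * (4 * a + 2) * (Nat.log 2 K + (2 * c + 2)) ^ (2 * c + 2) := by ring
      _ ≤ K * Nat.log 2 K := hK₁ K hK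
  calc (Matrix.det (∑ l, ((Polynomial.X : Polynomial ℝ) ^ d l) • (S l).map Polynomial.C)
          ).roots.toFinset.card ^ q
      ≤ (2 ^ (E + 2)) ^ q := Nat.pow_le_pow_left (hZ.trans hB) q
    _ = 2 ^ (q * (E + 2)) := by rw [← pow_mul, mul_comm]
    _ ≤ 2 ^ (K * Nat.log 2 K) := Nat.pow_le_pow_right (by norm_num) hexp

/-- **The line's composition**: the crux, BY NAME, from the one stub. -/
theorem MatrixDescartes_of : NegSquaresLaw → MatrixDescartes :=
  matrixDescartes_of_negSquaresLaw

/-- Instantiated: the crux from the registered stub (sorry lives only in `stub_negSquaresLaw`). -/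
theorem matrixDescartes_via_negSquares : MatrixDescartes :=
  MatrixDescartes_of stub_negSquaresLaw

end Summit.ValiantsHypothesis.ValiantsHypothesis.Cruxes.MatrixDescartes.NegSquares
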